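import Literature.AlgebraicGeometry.Motives.SepQuotientIntermediateFibres
import Literature.GroupTheory.Index.DoubleCosetCardinality
import HarnessLib

/-!
# Fibre MULTIPLICITIES of an intermediate quotient on geometric points: the coset-indexed orbit map `Γ/Γ₁ → (X/Γ₁)(Ω)`,
# `aΓ₁ ↦ q (a⁻¹ • P)`, its fibres (`S`-orbits of cosets, `S` the stabiliser of `P`), their sizes `[S : S ∩ aΓ₁a⁻¹]`,
# injectivity criteria, and FULL FIBRES `#r⁻¹(pP) = [Γ : Γ₁]` when the stabiliser lies in the kernel (free ∕ neat case)

Topic `AlgebraicGeometry/Motives`; namespace `Literature.AlgebraicGeometry.Motives`.  PROOF FILE (theorems only: no definition, no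
named fact, no instance, no notation, no `sorry`); sequel of ★ `Motives/SepQuotientIntermediateFibres.lean` (§3 there: the count of the
`r`-fibre of `X → X/Γ₁ →ʳ X/Γ` over a point with FREE orbit; §4: the finite-index form `act : Γ →* Aut X`, `N ⊴ Γ` of finite index
acting trivially, `Γ₁ ≤ Γ`).

Setting (= ★ §4 verbatim).  `k` a field, `τ : k →+* Ω` with `Ω` algebraically closed, `X Y Z : SchemeOver k` with `X` projective and
`Y`, `Z` separated, `Γ` ANY group acting by `act : Γ →* Aut X` through a finite quotient (`N ⊴ Γ`, `[N.FiniteIndex]`, `act n = 1`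
for `n ∈ N`), `Γ₁ ≤ Γ` a subgroup (NOT assumed normal), `q : X ⟶ Z` a separated quotient by `Γ₁` (`IsSepQuotient (fun h : Γ₁ => act h) q`),
`p : X ⟶ Y` one by `Γ`, `q ≫ r = p`, and `P ∈ X(Ω)`.  The STABILISER of `P` enters instance-free as any subgroup `S ≤ Γ` with
`hS : g ∈ S ↔ g • P = P` (`g • P` is written `AlgPoints.map (act g).hom P`, Mathlib's `Aut`-convention makes it a left action, ★
`map_hom_act_mul`).

* §1 (pure; any field of points `L ⊇ k`) `map_act_inv_eq_of_coe_eq`: `a ↦ q (a⁻¹ • P)` is constant on LEFT cosets `aΓ₁`;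
  `exists_quotient_desc_map_act_inv`: it descends to some `ψ : Γ/Γ₁ → Z(L)` with `ψ (aΓ₁) = q (a⁻¹ • P)` — every later statement is
  about ANY `ψ` with this property (hypothesis `hψ`), so consumers may bring their own `lift`; `map_act_mul_mul_inv_eq_self_iff`
  (`(b h a⁻¹) • P = P ↔ (h a⁻¹) • P = b⁻¹ • P`).
* §2 (geometric) **`map_act_inv_eq_map_act_inv_iff_mem_orbit`**: `q (a⁻¹ • P) = q (b⁻¹ • P) ↔ bΓ₁ ∈ S · (aΓ₁)` (the `S`-orbit in
  `Γ/Γ₁`, i.e. `b ∈ S a Γ₁`); `setOf_apply_eq_apply_coe_eq_orbit` (`{c ∣ ψ c = ψ (aΓ₁)} = S · (aΓ₁)`);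
  **`natCard_apply_eq_apply_coe_eq_relIndex`**: `#{c ∣ ψ c = ψ (aΓ₁)} = [S : S ∩ aΓ₁a⁻¹]` (`Subgroup.relIndex`; orbit–stabiliser, ★
  `Literature/GroupTheory/Index/DoubleCosetCardinality`) and the product form `natCard_apply_eq_apply_coe_mul_natCard_inf`
  (`#{…} · |S ∩ aΓ₁a⁻¹| = |S|`); **injectivity**: `coe_eq_coe_of_map_act_inv_eq` / `eq_coe_of_apply_eq_apply_coe` /
  `natCard_apply_eq_apply_coe_eq_one` (through ONE coset `aΓ₁`, from «every `g` fixing `P` lies in `aΓ₁a⁻¹`» — the stabiliser need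
  not be named), `injective_of_forall_stabilizer_le`, **`injective_of_stabilizer_le_normal`** (stabiliser inside a normal `N₁ ≤ Γ₁`,
  e.g. the trivially-acting kernel: the NEAT case); `range_eq_setOf_map_eq` / `exists_apply_eq_of_map_eq` (`ψ` maps `Γ/Γ₁` ONTO the
  `r`-fibre over `p P`); **`natCard_setOf_map_eq_eq_index_of_stabilizer_le(_normal)`** — FULL FIBRES `#{Q ∣ r Q = p P} = [Γ : Γ₁]`
  when the stabiliser lies in the kernel (free ∕ neat case), `Set.ncard` spelling.

SGA 1 V §1–§2 in the tree's currency: for `H ≤ G` finite acting on `X`, the geometric fibre of `X/H → X/G` over the orbit of `P` is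
`H\G/S_P` (double cosets), the coset `gH ∈ G/H` (equivalently `Hg⁻¹`) landing on the double coset `H g⁻¹ S_P`; the number of cosets
over one fibre point is `[S_P : S_P ∩ gHg⁻¹]`.

Use (cell `hodgecm-mathlib`, FLOOR 0, P5a, crux `HLiu418` = stmt-HodgeConjecture-24832, line `F0_D9opRoad2`, ED. 5.1 letter FULL
`RecordNeatLevelFullFibres`, F0P5a-plan (g3) 2026-08-31 row (b12) «NEAT-FREE»): for the Shimura-curve tower `M_{N′} → M_{K₁} → M_{Kc}`
(`N′ ⊴ Kc` small, `K₁ ≤ Kc`, `Kc` acting on `M_{N′}` through `Kc/N′`), torsion-freeness of `Kc` makes the action FREE modulo `N′` on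
`Ω`-points; with `Γ = Kc`, `Γ₁ = K₁`, `N = N′` this file then gives: the descended orbit map `Kc/K₁ → u′⁻¹(z)` is injective
(`injective_of_stabilizer_le_normal`) with range the whole fibre (`range_eq_setOf_map_eq`), hence **`#u′⁻¹(z) = [Kc : K₁]`**
(`natCard_setOf_map_eq_eq_index_of_stabilizer_le_normal`) — the counting half of the letter; the freeness itself is record currency
(complex uniformisation) and is NOT in this file.  At a NON-free point the same map has the fibre multiplicities of §2.  HC_CM is proved
only modulo the 7 printed citations until rung 0 of the ladder closes; this file is unconditional.

## References
* [SGA1] A. Grothendieck, M. Raynaud, *SGA 1*, Exp. V §1 Prop. 1.1 (ii) (geometric fibres of `X → X/G` are orbits), §2 (`X/H` for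
  `H ≤ G`; decomposition and inertia subgroups).
* [MumfordAV1970] D. Mumford, *Abelian Varieties* (1970), §7 Thm. p. 66 (1)–(3).
* [Milne2005ShimuraVarieties] J. S. Milne, *Introduction to Shimura varieties* (2005), §5 p. 57 L7–12 (`Sh_K = Sh_{K′}/(K/K′)`), §13
  p. 118 L21–26 (Hecke correspondences via `K ∩ gKg⁻¹`).
* [MccoyJanusz2001] N. H. McCoy, G. J. Janusz, *Introduction to Abstract Algebra*, 6th ed. (2001), Ch. II §5 Ex. 12 (b) p. 167
  (`|HaK| = |H||K|/|H ∩ aKa⁻¹|`; ★ `DoubleCosetCardinality`).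
-/

set_option autoImplicit false

noncomputable section

open CategoryTheory AlgebraicGeometry

namespace Literature.AlgebraicGeometry.Motives

/-! ## STABILISER form: the coset-indexed orbit map `aΓ₁ ↦ q (a⁻¹ • P)`, its fibres and their sizes

★ `SepQuotientIntermediateFibres` §3 counts the `r`-fibre when the stabiliser of `P` is trivial.  In general let `S ≤ Γ` be the stabiliser of the `Ω`-point `P`
(entered instance-free as ANY subgroup `S` with `g ∈ S ↔ g • P = P`).  The orbit map descends to LEFT cosets of `Γ₁` in the
convention `a ↦ q (a⁻¹ • P)` (`q ((a h)⁻¹ • P) = q (h⁻¹ • (a⁻¹ • P)) = q (a⁻¹ • P)` for `h ∈ Γ₁`); on `Γ/Γ₁` it hits exactly the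
`r`-fibre over `p P` (§4), and two cosets `aΓ₁`, `bΓ₁` have the same image iff `b ∈ S a Γ₁`, i.e. iff `bΓ₁` lies in the `S`-ORBIT
of `aΓ₁` in `Γ/Γ₁`; so the fibre of the descended map through `aΓ₁` has `[S : S ∩ aΓ₁a⁻¹]` elements (orbit–stabiliser, ★
`Literature/GroupTheory/Index/DoubleCosetCardinality`), and the map is injective through `aΓ₁` iff `S ≤ aΓ₁a⁻¹` — in particular
injective as soon as the stabiliser lies in a normal subgroup contained in `Γ₁` (e.g. the trivially-acting kernel: the NEAT case).
[SGA1] V §1 Prop. 1.1 (ii), §2; [Milne2005ShimuraVarieties] §5 p. 57 (`Sh_K = Sh_{K′}/(K/K′)`), §13 p. 118 (`K ∩ gKg⁻¹`).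

Use (cell `hodgecm-mathlib`, line `F0_D9opRoad2`, ED. 5.1 row (b12)): with `Γ = Kc`, `Γ₁ = K₁`, `act k = T_{k⁻¹}` on `X = M_{N′}`, the
descended map `kK₁ ↦ T_k x` is the level-change fibre map `Kc/K₁ → u′⁻¹(u x)`; free action modulo `N′` ⇒ injective with full range ⇒
`#u′⁻¹(u x) = [Kc : K₁]`.  Generic capital only: no record object here.
-/

section StabilizerPure

variable {k : Type} [Field k] {L : Type} [Field L] [Algebra k L] {Γ : Type} [Group Γ] {X Z : SchemeOver k}
  (act : Γ →* Aut X) (Γ₁ : Subgroup Γ) {q : X ⟶ Z}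

/-- **The orbit map `a ↦ q (a⁻¹ • P)` is constant on left cosets of `Γ₁`** when `q` is a separated quotient by `Γ₁` (acting through
`act`): `aΓ₁ = bΓ₁ ⇒ q (a⁻¹ • P) = q (b⁻¹ • P)` (indeed `b⁻¹ = (a⁻¹b)⁻¹ a⁻¹` with `a⁻¹ b ∈ Γ₁`).  Any field of points `L ⊇ k`.
[cite: SGA1, Exp. V §1 Prop. 1.1] [cite: MumfordAV1970, §7 Thm. p. 66 (1)] -/
theorem map_act_inv_eq_of_coe_eq (hq : IsSepQuotient (fun h : Γ₁ => act h) q) (P : AlgPoints X L) {a b : Γ}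
    (h : (a : Γ ⧸ Γ₁) = b) :
    AlgPoints.map q (AlgPoints.map (act a⁻¹).hom P) = AlgPoints.map q (AlgPoints.map (act b⁻¹).hom P) := by
  have hab : a⁻¹ * b ∈ Γ₁ := QuotientGroup.eq.1 h
  have hq' : IsSepQuotient (fun h => (act.comp Γ₁.subtype) h) q := hq
  have e : b⁻¹ = (a⁻¹ * b)⁻¹ * a⁻¹ := by group
  rw [e, map_hom_act_mul]
  exact (map_act_eq_of_isSepQuotient (act.comp Γ₁.subtype) hq' (⟨a⁻¹ * b, hab⟩ : Γ₁)⁻¹ _).symm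

/-- **The descended orbit map exists**: there is `ψ : Γ/Γ₁ → Z(L)` with `ψ (aΓ₁) = q (a⁻¹ • P)` for all `a : Γ`
(`map_act_inv_eq_of_coe_eq`).  [cite: SGA1, Exp. V §1 Prop. 1.1] -/
theorem exists_quotient_desc_map_act_inv (hq : IsSepQuotient (fun h : Γ₁ => act h) q) (P : AlgPoints X L) :
    ∃ ψ : Γ ⧸ Γ₁ → AlgPoints Z L, ∀ a : Γ, ψ (a : Γ ⧸ Γ₁) = AlgPoints.map q (AlgPoints.map (act a⁻¹).hom P) :=
  ⟨fun c => Quotient.liftOn' c (fun a => AlgPoints.map q (AlgPoints.map (act a⁻¹).hom P))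
      (fun _ _ hab => map_act_inv_eq_of_coe_eq act Γ₁ hq P (Quotient.sound' hab)),
    fun _ => rfl⟩

/-- Bookkeeping for the left action on points: **`(b h a⁻¹) • P = P ↔ (h a⁻¹) • P = b⁻¹ • P`** (apply `b⁻¹`, resp. `b`) —
the bridge between «`b h a⁻¹` lies in the stabiliser of `P`» and the fibre relation of ★ §4 `map_act_eq_map_act_iff_of_finiteIndex`.
[cite: MumfordAV1970, §7 Thm. p. 66 (1)] -/
theorem map_act_mul_mul_inv_eq_self_iff (P : AlgPoints X L) (a b h : Γ) :
    AlgPoints.map (act (b * h * a⁻¹)).hom P = P ↔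
      AlgPoints.map (act (h * a⁻¹)).hom P = AlgPoints.map (act b⁻¹).hom P := by
  constructor
  · intro e
    have e' : AlgPoints.map (act b⁻¹).hom (AlgPoints.map (act (b * h * a⁻¹)).hom P)
        = AlgPoints.map (act (h * a⁻¹)).hom P := by
      rw [← map_hom_act_mul, show b⁻¹ * (b * h * a⁻¹) = h * a⁻¹ by group]
    rw [e] at e'
    exact e'.symm
  · intro e
    rw [mul_assoc, map_hom_act_mul, e, ← map_hom_act_mul, mul_inv_cancel, map_hom_act_one]

end StabilizerPure

section Stabilizer

variable {k Ω : Type} [Field k] [Field Ω] [IsAlgClosed Ω] (τ : k →+* Ω) {Γ : Type} [Group Γ]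
  {X Y Z : SchemeOver k} (act : Γ →* Aut X) (Γ₁ N : Subgroup Γ) [N.Normal] [N.FiniteIndex]
  (p : X ⟶ Y) (q : X ⟶ Z) (r : Z ⟶ Y)

/-- **Same image ⟺ same `S`-orbit of cosets.**  `X` projective over `k`, `Z` separated, `q : X ⟶ Z` a separated quotient by `Γ₁ ≤ Γ`
acting through `act : Γ →* Aut X` (`Γ` ANY group, `N ⊴ Γ` of finite index acting trivially), `P ∈ X(Ω)`, and `S ≤ Γ` the
stabiliser of `P` (`g ∈ S ↔ g • P = P`).  Then `q (a⁻¹ • P) = q (b⁻¹ • P) ↔ bΓ₁ ∈ S · (aΓ₁)` in `Γ/Γ₁` — i.e. `b ∈ S a Γ₁`.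
Proof: by §4 the left side is `∃ h ∈ Γ₁, (h a⁻¹) • P = b⁻¹ • P`, i.e. `b h a⁻¹ ∈ S`, i.e. `b = s a h⁻¹`.
[cite: SGA1, Exp. V §1 Prop. 1.1 (ii) and §2] [cite: Milne2005ShimuraVarieties, §13 p. 118 L21–26] -/
theorem map_act_inv_eq_map_act_inv_iff_mem_orbit (hX : IsProjectiveOver X) (hZ : IsSeparated Z.hom)
    (hN : ∀ n ∈ N, act n = 1) (hq : IsSepQuotient (fun h : Γ₁ => act h) q) (P : letI := τ.toAlgebra; AlgPoints X Ω)
    (S : Subgroup Γ) (hS : letI := τ.toAlgebra; ∀ g : Γ, g ∈ S ↔ AlgPoints.map (act g).hom P = P) (a b : Γ) :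
    letI := τ.toAlgebra
    AlgPoints.map q (AlgPoints.map (act a⁻¹).hom P) = AlgPoints.map q (AlgPoints.map (act b⁻¹).hom P)
      ↔ (b : Γ ⧸ Γ₁) ∈ MulAction.orbit S (a : Γ ⧸ Γ₁) := by
  letI := τ.toAlgebra
  rw [map_act_eq_map_act_iff_of_finiteIndex τ act Γ₁ N q hX hZ hN hq P a⁻¹ b⁻¹, MulAction.mem_orbit_iff]
  constructor
  · rintro ⟨h, hh, e⟩
    -- `b h a⁻¹ ∈ S`, and `(b h a⁻¹) • aΓ₁ = b h Γ₁ = bΓ₁`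
    have hs : b * h * a⁻¹ ∈ S := (hS _).2 ((map_act_mul_mul_inv_eq_self_iff act P a b h).2 e)
    refine ⟨⟨b * h * a⁻¹, hs⟩, ?_⟩
    change (b * h * a⁻¹ : Γ) • (a : Γ ⧸ Γ₁) = (b : Γ ⧸ Γ₁)
    rw [MulAction.Quotient.smul_coe, smul_eq_mul, inv_mul_cancel_right, QuotientGroup.eq,
      mul_inv_rev, inv_mul_cancel_right, inv_mem_iff]
    exact hh
  · rintro ⟨⟨s, hs⟩, e⟩
    change (s : Γ) • (a : Γ ⧸ Γ₁) = (b : Γ ⧸ Γ₁) at e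
    rw [MulAction.Quotient.smul_coe, smul_eq_mul, QuotientGroup.eq] at e
    -- `e : (s a)⁻¹ b ∈ Γ₁`; take `h = ((s a)⁻¹ b)⁻¹`, so that `b h a⁻¹ = s`
    refine ⟨((s * a)⁻¹ * b)⁻¹, inv_mem e, ?_⟩
    rw [← map_act_mul_mul_inv_eq_self_iff act P a b]
    have e2 : b * ((s * a)⁻¹ * b)⁻¹ * a⁻¹ = s := by group
    rw [e2]
    exact (hS s).1 hs

/-- **The fibre of the descended orbit map through `aΓ₁` is the `S`-orbit of `aΓ₁`**: for any `ψ : Γ/Γ₁ → Z(Ω)` with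
`ψ (aΓ₁) = q (a⁻¹ • P)` (it exists: `exists_quotient_desc_map_act_inv`), `{c ∣ ψ c = ψ (aΓ₁)} = S · (aΓ₁)`.
[cite: SGA1, Exp. V §1 Prop. 1.1 (ii) and §2] -/
theorem setOf_apply_eq_apply_coe_eq_orbit (hX : IsProjectiveOver X) (hZ : IsSeparated Z.hom)
    (hN : ∀ n ∈ N, act n = 1) (hq : IsSepQuotient (fun h : Γ₁ => act h) q) (P : letI := τ.toAlgebra; AlgPoints X Ω)
    (S : Subgroup Γ) (hS : letI := τ.toAlgebra; ∀ g : Γ, g ∈ S ↔ AlgPoints.map (act g).hom P = P)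
    (ψ : letI := τ.toAlgebra; Γ ⧸ Γ₁ → AlgPoints Z Ω)
    (hψ : letI := τ.toAlgebra; ∀ a : Γ, ψ (a : Γ ⧸ Γ₁) = AlgPoints.map q (AlgPoints.map (act a⁻¹).hom P)) (a : Γ) :
    {c : Γ ⧸ Γ₁ | ψ c = ψ (a : Γ ⧸ Γ₁)} = MulAction.orbit S (a : Γ ⧸ Γ₁) := by
  letI := τ.toAlgebra
  ext c
  induction c using QuotientGroup.induction_on with
  | H b =>
    rw [Set.mem_setOf_eq, hψ, hψ, eq_comm]
    exact map_act_inv_eq_map_act_inv_iff_mem_orbit τ act Γ₁ N q hX hZ hN hq P S hS a b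

/-- **FIBRE MULTIPLICITY of the descended orbit map: `#{c ∣ ψ c = ψ (aΓ₁)} = [S : S ∩ aΓ₁a⁻¹]`** (the relative index of `aΓ₁a⁻¹`
in the stabiliser `S`; orbit–stabiliser for `S` acting on `Γ/Γ₁`, whose stabiliser at `aΓ₁` is `S ∩ aΓ₁a⁻¹`, ★
`stabilizer_quotientMk_eq_subgroupOf`).  `Nat.card` form: both sides are `0` when infinite.
[cite: SGA1, Exp. V §1 Prop. 1.1 (ii) and §2] [cite: Milne2005ShimuraVarieties, §13 p. 118 L21–26] -/
theorem natCard_apply_eq_apply_coe_eq_relIndex (hX : IsProjectiveOver X) (hZ : IsSeparated Z.hom)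
    (hN : ∀ n ∈ N, act n = 1) (hq : IsSepQuotient (fun h : Γ₁ => act h) q) (P : letI := τ.toAlgebra; AlgPoints X Ω)
    (S : Subgroup Γ) (hS : letI := τ.toAlgebra; ∀ g : Γ, g ∈ S ↔ AlgPoints.map (act g).hom P = P)
    (ψ : letI := τ.toAlgebra; Γ ⧸ Γ₁ → AlgPoints Z Ω)
    (hψ : letI := τ.toAlgebra; ∀ a : Γ, ψ (a : Γ ⧸ Γ₁) = AlgPoints.map q (AlgPoints.map (act a⁻¹).hom P)) (a : Γ) :
    Nat.card {c : Γ ⧸ Γ₁ // ψ c = ψ (a : Γ ⧸ Γ₁)} = (Γ₁.map (MulAut.conj a).toMonoidHom).relIndex S := by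
  letI := τ.toAlgebra
  have e := setOf_apply_eq_apply_coe_eq_orbit τ act Γ₁ N q hX hZ hN hq P S hS ψ hψ a
  rw [← Set.coe_setOf, e, Nat.card_coe_set_eq, ← MulAction.index_stabilizer,
    Literature.GroupTheory.Index.stabilizer_quotientMk_eq_subgroupOf S Γ₁ a, Subgroup.relIndex]

/-- **Product form: `#{c ∣ ψ c = ψ (aΓ₁)} · |S ∩ aΓ₁a⁻¹| = |S|`** (so the fibre multiplicity divides the order of the stabiliser).
[cite: SGA1, Exp. V §1 Prop. 1.1 (ii) and §2] -/
theorem natCard_apply_eq_apply_coe_mul_natCard_inf (hX : IsProjectiveOver X) (hZ : IsSeparated Z.hom)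
    (hN : ∀ n ∈ N, act n = 1) (hq : IsSepQuotient (fun h : Γ₁ => act h) q) (P : letI := τ.toAlgebra; AlgPoints X Ω)
    (S : Subgroup Γ) (hS : letI := τ.toAlgebra; ∀ g : Γ, g ∈ S ↔ AlgPoints.map (act g).hom P = P)
    (ψ : letI := τ.toAlgebra; Γ ⧸ Γ₁ → AlgPoints Z Ω)
    (hψ : letI := τ.toAlgebra; ∀ a : Γ, ψ (a : Γ ⧸ Γ₁) = AlgPoints.map q (AlgPoints.map (act a⁻¹).hom P)) (a : Γ) :
    Nat.card {c : Γ ⧸ Γ₁ // ψ c = ψ (a : Γ ⧸ Γ₁)} * Nat.card (S ⊓ Γ₁.map (MulAut.conj a).toMonoidHom : Subgroup Γ)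
      = Nat.card S := by
  letI := τ.toAlgebra
  have e := setOf_apply_eq_apply_coe_eq_orbit τ act Γ₁ N q hX hZ hN hq P S hS ψ hψ a
  rw [← Set.coe_setOf, e, ← Literature.GroupTheory.Index.natCard_stabilizer_quotientMk S Γ₁ a]
  exact Literature.GroupTheory.Index.natCard_orbit_mul_natCard_stabilizer S Γ₁ (a : Γ ⧸ Γ₁)

/-- **Injectivity THROUGH ONE COSET, stabiliser-free form**: if every `g` fixing `P` lies in `aΓ₁a⁻¹`, then
`q (b⁻¹ • P) = q (a⁻¹ • P)` forces `bΓ₁ = aΓ₁` (from §4: `b h a⁻¹` fixes `P` for some `h ∈ Γ₁`, hence `a⁻¹ (b h a⁻¹) a = a⁻¹ b h ∈ Γ₁`).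
This is the shape «`lift` is injective over the point `lift (aΓ₁)`».  [cite: SGA1, Exp. V §1 Prop. 1.1 (ii) and §2] -/
theorem coe_eq_coe_of_map_act_inv_eq (hX : IsProjectiveOver X) (hZ : IsSeparated Z.hom)
    (hN : ∀ n ∈ N, act n = 1) (hq : IsSepQuotient (fun h : Γ₁ => act h) q) (P : letI := τ.toAlgebra; AlgPoints X Ω) (a : Γ)
    (ha : letI := τ.toAlgebra; ∀ g : Γ, AlgPoints.map (act g).hom P = P → g ∈ Γ₁.map (MulAut.conj a).toMonoidHom) (b : Γ)
    (h : letI := τ.toAlgebra;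
      AlgPoints.map q (AlgPoints.map (act b⁻¹).hom P) = AlgPoints.map q (AlgPoints.map (act a⁻¹).hom P)) :
    (b : Γ ⧸ Γ₁) = a := by
  letI := τ.toAlgebra
  rw [eq_comm, map_act_eq_map_act_iff_of_finiteIndex τ act Γ₁ N q hX hZ hN hq P a⁻¹ b⁻¹] at h
  obtain ⟨h₁, hh₁, e⟩ := h
  have hfix : AlgPoints.map (act (b * h₁ * a⁻¹)).hom P = P := (map_act_mul_mul_inv_eq_self_iff act P a b h₁).2 e
  have hmem := ha _ hfix
  rw [Literature.GroupTheory.Index.mem_map_conj_iff] at hmem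
  -- `hmem : a⁻¹ * (b * h₁ * a⁻¹) * a ∈ Γ₁`, i.e. `a⁻¹ * b * h₁ ∈ Γ₁`
  have e2 : a⁻¹ * (b * h₁ * a⁻¹) * a = a⁻¹ * b * h₁ := by group
  rw [e2] at hmem
  have h2 : a⁻¹ * b ∈ Γ₁ := by
    have h3 := mul_mem hmem (inv_mem hh₁)
    rwa [mul_inv_cancel_right] at h3
  rw [QuotientGroup.eq, show b⁻¹ * a = (a⁻¹ * b)⁻¹ by rw [mul_inv_rev, inv_inv]]
  exact inv_mem h2

/-- **`ψ` is injective through `aΓ₁`** (descended form of `coe_eq_coe_of_map_act_inv_eq`): `ψ c = ψ (aΓ₁) → c = aΓ₁` whenever the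
stabiliser of `P` lies in `aΓ₁a⁻¹`.  [cite: SGA1, Exp. V §1 Prop. 1.1 (ii) and §2] -/
theorem eq_coe_of_apply_eq_apply_coe (hX : IsProjectiveOver X) (hZ : IsSeparated Z.hom)
    (hN : ∀ n ∈ N, act n = 1) (hq : IsSepQuotient (fun h : Γ₁ => act h) q) (P : letI := τ.toAlgebra; AlgPoints X Ω) (a : Γ)
    (ha : letI := τ.toAlgebra; ∀ g : Γ, AlgPoints.map (act g).hom P = P → g ∈ Γ₁.map (MulAut.conj a).toMonoidHom)
    (ψ : letI := τ.toAlgebra; Γ ⧸ Γ₁ → AlgPoints Z Ω)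
    (hψ : letI := τ.toAlgebra; ∀ a : Γ, ψ (a : Γ ⧸ Γ₁) = AlgPoints.map q (AlgPoints.map (act a⁻¹).hom P))
    (c : Γ ⧸ Γ₁) (hc : ψ c = ψ (a : Γ ⧸ Γ₁)) : c = a := by
  letI := τ.toAlgebra
  induction c using QuotientGroup.induction_on with
  | H b =>
    rw [hψ, hψ] at hc
    exact coe_eq_coe_of_map_act_inv_eq τ act Γ₁ N q hX hZ hN hq P a ha b hc

/-- **The fibre through `aΓ₁` is a singleton when the stabiliser lies in `aΓ₁a⁻¹`**: `#{c ∣ ψ c = ψ (aΓ₁)} = 1`.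
[cite: SGA1, Exp. V §1 Prop. 1.1 (ii) and §2] -/
theorem natCard_apply_eq_apply_coe_eq_one (hX : IsProjectiveOver X) (hZ : IsSeparated Z.hom)
    (hN : ∀ n ∈ N, act n = 1) (hq : IsSepQuotient (fun h : Γ₁ => act h) q) (P : letI := τ.toAlgebra; AlgPoints X Ω) (a : Γ)
    (ha : letI := τ.toAlgebra; ∀ g : Γ, AlgPoints.map (act g).hom P = P → g ∈ Γ₁.map (MulAut.conj a).toMonoidHom)
    (ψ : letI := τ.toAlgebra; Γ ⧸ Γ₁ → AlgPoints Z Ω)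
    (hψ : letI := τ.toAlgebra; ∀ a : Γ, ψ (a : Γ ⧸ Γ₁) = AlgPoints.map q (AlgPoints.map (act a⁻¹).hom P)) :
    Nat.card {c : Γ ⧸ Γ₁ // ψ c = ψ (a : Γ ⧸ Γ₁)} = 1 := by
  letI := τ.toAlgebra
  rw [Nat.card_eq_one_iff_exists]
  exact ⟨⟨(a : Γ ⧸ Γ₁), rfl⟩, fun ⟨c, hc⟩ =>
    Subtype.ext (eq_coe_of_apply_eq_apply_coe τ act Γ₁ N q hX hZ hN hq P a ha ψ hψ c hc)⟩

/-- **Global injectivity**: if the stabiliser of `P` lies in EVERY conjugate `aΓ₁a⁻¹` — e.g. if it lies in a normal subgroup of `Γ`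
contained in `Γ₁` (`injective_of_stabilizer_le_normal`) — the descended orbit map `ψ : Γ/Γ₁ → Z(Ω)` is injective, hence a
bijection onto the `r`-fibre over `p P` (`range_eq_setOf_map_eq`).  [cite: SGA1, Exp. V §1 Prop. 1.1 (ii) and §2] -/
theorem injective_of_forall_stabilizer_le (hX : IsProjectiveOver X) (hZ : IsSeparated Z.hom)
    (hN : ∀ n ∈ N, act n = 1) (hq : IsSepQuotient (fun h : Γ₁ => act h) q) (P : letI := τ.toAlgebra; AlgPoints X Ω)
    (hP : letI := τ.toAlgebra; ∀ g : Γ, AlgPoints.map (act g).hom P = P → ∀ a : Γ, g ∈ Γ₁.map (MulAut.conj a).toMonoidHom)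
    (ψ : letI := τ.toAlgebra; Γ ⧸ Γ₁ → AlgPoints Z Ω)
    (hψ : letI := τ.toAlgebra; ∀ a : Γ, ψ (a : Γ ⧸ Γ₁) = AlgPoints.map q (AlgPoints.map (act a⁻¹).hom P)) :
    Function.Injective ψ := by
  letI := τ.toAlgebra
  intro c c' hcc'
  induction c' using QuotientGroup.induction_on with
  | H a => exact eq_coe_of_apply_eq_apply_coe τ act Γ₁ N q hX hZ hN hq P a (fun g hg => hP g hg a) ψ hψ c hcc'

/-- **Global injectivity, NORMAL-KERNEL form (the neat case)**: if every `g ∈ Γ` fixing `P` lies in a normal subgroup `N₁ ⊴ Γ` with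
`N₁ ≤ Γ₁` (typically: the stabiliser of `P` IS the trivially-acting kernel), then `ψ` is injective.
[cite: SGA1, Exp. V §1 Prop. 1.1 (ii) and §2] [cite: Milne2005ShimuraVarieties, §5 p. 57 L7–12] -/
theorem injective_of_stabilizer_le_normal (hX : IsProjectiveOver X) (hZ : IsSeparated Z.hom)
    (hN : ∀ n ∈ N, act n = 1) (hq : IsSepQuotient (fun h : Γ₁ => act h) q) (P : letI := τ.toAlgebra; AlgPoints X Ω)
    (N₁ : Subgroup Γ) [N₁.Normal] (hN₁ : N₁ ≤ Γ₁)
    (hP : letI := τ.toAlgebra; ∀ g : Γ, AlgPoints.map (act g).hom P = P → g ∈ N₁)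
    (ψ : letI := τ.toAlgebra; Γ ⧸ Γ₁ → AlgPoints Z Ω)
    (hψ : letI := τ.toAlgebra; ∀ a : Γ, ψ (a : Γ ⧸ Γ₁) = AlgPoints.map q (AlgPoints.map (act a⁻¹).hom P)) :
    Function.Injective ψ := by
  letI := τ.toAlgebra
  refine injective_of_forall_stabilizer_le τ act Γ₁ N q hX hZ hN hq P (fun g hg a => ?_) ψ hψ
  rw [Literature.GroupTheory.Index.mem_map_conj_iff]
  exact hN₁ (Subgroup.Normal.conj_mem' inferInstance g (hP g hg) a)

/-- **The descended orbit map hits exactly the `r`-fibre over `p P`** (`q ≫ r = p`, `p` a separated quotient by `Γ`, `Y` separated):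
`range ψ = {Q ∣ r Q = p P}` — §4 `map_eq_map_iff_exists_eq_map_act_of_finiteIndex` reparametrised by `g = a⁻¹`.
[cite: SGA1, Exp. V §1 Prop. 1.1 (ii) and §2] -/
theorem range_eq_setOf_map_eq (hX : IsProjectiveOver X) (hY : IsSeparated Y.hom) (hZ : IsSeparated Z.hom)
    (hN : ∀ n ∈ N, act n = 1) (hp : IsSepQuotient (fun g => act g) p) (hq : IsSepQuotient (fun h : Γ₁ => act h) q)
    (hqr : q ≫ r = p) (P : letI := τ.toAlgebra; AlgPoints X Ω) (ψ : letI := τ.toAlgebra; Γ ⧸ Γ₁ → AlgPoints Z Ω)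
    (hψ : letI := τ.toAlgebra; ∀ a : Γ, ψ (a : Γ ⧸ Γ₁) = AlgPoints.map q (AlgPoints.map (act a⁻¹).hom P)) :
    letI := τ.toAlgebra
    Set.range ψ = {Q : AlgPoints Z Ω | AlgPoints.map r Q = AlgPoints.map p P} := by
  letI := τ.toAlgebra
  ext Q
  rw [Set.mem_range, Set.mem_setOf_eq, map_eq_map_iff_exists_eq_map_act_of_finiteIndex τ act Γ₁ N p q r hX hY hZ hN hp hq hqr P Q]
  constructor
  · rintro ⟨c, rfl⟩
    induction c using QuotientGroup.induction_on with
    | H a => exact ⟨a⁻¹, hψ a⟩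
  · rintro ⟨g, rfl⟩
    exact ⟨(g⁻¹ : Γ), by rw [hψ, inv_inv]⟩

/-- **Every point of the `r`-fibre over `p P` is `ψ` of some coset** (surjectivity onto the fibre; cf. ★
`UnitaryShimuraCurveLevelFibreTranslates` for the record tower).  [cite: SGA1, Exp. V §1 Prop. 1.1 (ii) and §2] -/
theorem exists_apply_eq_of_map_eq (hX : IsProjectiveOver X) (hY : IsSeparated Y.hom) (hZ : IsSeparated Z.hom)
    (hN : ∀ n ∈ N, act n = 1) (hp : IsSepQuotient (fun g => act g) p) (hq : IsSepQuotient (fun h : Γ₁ => act h) q)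
    (hqr : q ≫ r = p) (P : letI := τ.toAlgebra; AlgPoints X Ω) (ψ : letI := τ.toAlgebra; Γ ⧸ Γ₁ → AlgPoints Z Ω)
    (hψ : letI := τ.toAlgebra; ∀ a : Γ, ψ (a : Γ ⧸ Γ₁) = AlgPoints.map q (AlgPoints.map (act a⁻¹).hom P))
    (Q : letI := τ.toAlgebra; AlgPoints Z Ω) (hQ : letI := τ.toAlgebra; AlgPoints.map r Q = AlgPoints.map p P) :
    ∃ c : Γ ⧸ Γ₁, ψ c = Q := by
  letI := τ.toAlgebra
  have hQ' : Q ∈ Set.range ψ := by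
    rw [range_eq_setOf_map_eq τ act Γ₁ N p q r hX hY hZ hN hp hq hqr P ψ hψ]
    exact hQ
  exact hQ'

/-- **FULL FIBRES: `#{Q ∣ r Q = p P} = [Γ : Γ₁]` when the stabiliser of `P` lies in a normal subgroup `N₁ ≤ Γ₁`** (e.g. the trivially-acting
kernel — the FREE ∕ NEAT case): the descended orbit map `Γ/Γ₁ → Z(Ω)` is injective (`injective_of_stabilizer_le_normal`) with range the
`r`-fibre over `p P` (`range_eq_setOf_map_eq`), so the fibre has exactly `Γ₁.index = #(Γ/Γ₁)` points (`Nat.card` form; for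
`Γ₁ = K₁.subgroupOf Kc` this is `K₁.relIndex Kc`).  [cite: SGA1, Exp. V §1 Prop. 1.1 (ii) and §2]
[cite: Milne2005ShimuraVarieties, §5 p. 57 L7–12] -/
theorem natCard_setOf_map_eq_eq_index_of_stabilizer_le_normal (hX : IsProjectiveOver X) (hY : IsSeparated Y.hom)
    (hZ : IsSeparated Z.hom) (hN : ∀ n ∈ N, act n = 1) (hp : IsSepQuotient (fun g => act g) p)
    (hq : IsSepQuotient (fun h : Γ₁ => act h) q) (hqr : q ≫ r = p) (P : letI := τ.toAlgebra; AlgPoints X Ω)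
    (N₁ : Subgroup Γ) [N₁.Normal] (hN₁ : N₁ ≤ Γ₁)
    (hP : letI := τ.toAlgebra; ∀ g : Γ, AlgPoints.map (act g).hom P = P → g ∈ N₁) :
    letI := τ.toAlgebra
    Nat.card {Q : AlgPoints Z Ω // AlgPoints.map r Q = AlgPoints.map p P} = Γ₁.index := by
  letI := τ.toAlgebra
  obtain ⟨ψ, hψ⟩ := exists_quotient_desc_map_act_inv act Γ₁ hq P
  have hinj := injective_of_stabilizer_le_normal τ act Γ₁ N q hX hZ hN hq P N₁ hN₁ hP ψ hψ
  have hrange := range_eq_setOf_map_eq τ act Γ₁ N p q r hX hY hZ hN hp hq hqr P ψ hψ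
  rw [Subgroup.index, ← Set.coe_setOf, ← hrange]
  exact (Nat.card_congr (Equiv.ofInjective ψ hinj)).symm

/-- The same with the trivially-acting kernel `N` itself as the normal subgroup (`N ≤ Γ₁`): **free action modulo the kernel ⇒ full
fibres of cardinal `[Γ : Γ₁]`.**  [cite: SGA1, Exp. V §1 Prop. 1.1 (ii) and §2] [cite: Milne2005ShimuraVarieties, §5 p. 57 L7–12] -/
theorem natCard_setOf_map_eq_eq_index_of_stabilizer_le (hX : IsProjectiveOver X) (hY : IsSeparated Y.hom)
    (hZ : IsSeparated Z.hom) (hN : ∀ n ∈ N, act n = 1) (hNΓ₁ : N ≤ Γ₁) (hp : IsSepQuotient (fun g => act g) p)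
    (hq : IsSepQuotient (fun h : Γ₁ => act h) q) (hqr : q ≫ r = p) (P : letI := τ.toAlgebra; AlgPoints X Ω)
    (hP : letI := τ.toAlgebra; ∀ g : Γ, AlgPoints.map (act g).hom P = P → g ∈ N) :
    letI := τ.toAlgebra
    Nat.card {Q : AlgPoints Z Ω // AlgPoints.map r Q = AlgPoints.map p P} = Γ₁.index :=
  natCard_setOf_map_eq_eq_index_of_stabilizer_le_normal τ act Γ₁ N p q r hX hY hZ hN hp hq hqr P N hNΓ₁ hP

/-- `Set.ncard` spelling of the full-fibre count.  [cite: SGA1, Exp. V §1 Prop. 1.1 (ii) and §2] -/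
theorem ncard_setOf_map_eq_eq_index_of_stabilizer_le (hX : IsProjectiveOver X) (hY : IsSeparated Y.hom)
    (hZ : IsSeparated Z.hom) (hN : ∀ n ∈ N, act n = 1) (hNΓ₁ : N ≤ Γ₁) (hp : IsSepQuotient (fun g => act g) p)
    (hq : IsSepQuotient (fun h : Γ₁ => act h) q) (hqr : q ≫ r = p) (P : letI := τ.toAlgebra; AlgPoints X Ω)
    (hP : letI := τ.toAlgebra; ∀ g : Γ, AlgPoints.map (act g).hom P = P → g ∈ N) :
    letI := τ.toAlgebra
    {Q : AlgPoints Z Ω | AlgPoints.map r Q = AlgPoints.map p P}.ncard = Γ₁.index := by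
  letI := τ.toAlgebra
  rw [← Nat.card_coe_set_eq, Set.coe_setOf]
  exact natCard_setOf_map_eq_eq_index_of_stabilizer_le τ act Γ₁ N p q r hX hY hZ hN hNΓ₁ hp hq hqr P hP

end Stabilizer


end Literature.AlgebraicGeometry.Motives

end
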